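import Summits.CriticalPhenomena.PercolationContinuityZ3.Theorems.PercNearOneGluingNoHeavyQuantFarGate3Final
import Summits.CriticalPhenomena.PercolationContinuityZ3.Theorems.PercNearOneGluingNoHeavyQuantFarGate3ZeroCover
import HarnessLib

/-!
# QUANT lane R8, front "FAR beyond trees", layer one — THE DEGREE-THREE GATE AT THE OBSERVER, LXXIX: NO OUTSIDE RELAY, and the
# hypothesis-free gate theorem `Quant.farLayerOne_of_gate3_all`

builds on p205010 (kernel theorem, internal audit signed; external expert review pending)

Support file (`--supports stmt-CriticalPhenomena-4575`), seat `prim-quant-p1` (gen 38); memo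
`run/shared/lean/prim/quant/prim-quant-p1-g38/FOR-LEAD-GATE3-ZERO.md`.  Standard axioms; no sorries; no definitions.

`Quant.farLayerOne_of_gate3` (file LXXVII, p1 g37) proves FAR(1) at every degree-three gate `v ∈ A` at the observer (`v ~ o, u₁, u₂`,
`u₁, u₂ ∈ A`, any weights, any environment) under `hout : 1 ≤ #(A ∖ {v,u₁,u₂})`.  Here the complementary case — NO outside relay,
`A = {v, u₁, u₂}`, an instance of `Z(3,2)` — is assembled from the five-type laws of files III/V/VIII (`Gate3.real_card_le_one_le`,
`Gate3.real_compl_openConn_v/u₁/u₂_eq`, `Gate3.real_types_sum`, `Gate3.real_harris₁`) and the five-cell cover lemma `Gate3.cover_zero`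
(file LXXVIII): `Quant.farLayerOne_of_gate3_zero`.  The fifteen-cell assembly of files XIII/XX is NOT used at `#(A∖{v,u₁,u₂}) = 0`: its
pure-real hypothesis there is true but tight (the spurious outside-count cells buy mean for free; sup = 2 exactly), while the five-cell
statement has margin `1/2` (violators have mean `≤ 3/2`).  Union of the two cases: **`Quant.farLayerOne_of_gate3_all`** — FAR(1) at EVERY
degree-three gate at the observer, with no hypothesis on the rest of `A`.
[cite: KozmaNitzan2024, Conjecture 3 (p. 15)]; [cite: Grimmett1999, §1.3 p. 10, §2.2, Thm. (2.4) p. 34]; [this work].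
-/

noncomputable section

namespace Summit.CriticalPhenomena.PercolationContinuityZ3.Theorems

namespace Quant

open Finset MeasureTheory Set
open Literature.Probability.LatticeModels
open Literature.Probability.Percolation
open Bundle (offZ)
open scoped Classical

variable {n : ℕ}

/-- **FAR(1) for the degree-three gate at the observer with NO outside relay** (`A ∖ {v, u₁, u₂} = ∅`): five-type assembly through
`Gate3.cover_zero`. [this work] -/
theorem farLayerOne_of_gate3_zero (w : Sym2 (Fin n) → unitInterval) (A : Finset (Fin n)) {o v u₁ u₂ : Fin n}
    (hov : o ≠ v) (h1v : u₁ ≠ v) (h2v : u₂ ≠ v) (ho1 : o ≠ u₁) (ho2 : o ≠ u₂) (h12 : u₁ ≠ u₂)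
    (hvA : v ∈ A) (h1A : u₁ ∈ A) (h2A : u₂ ∈ A)
    (hw : ∀ z : Fin n, z ≠ o → z ≠ u₁ → z ≠ u₂ → z ≠ v → (w s(v, z) : ℝ) = 0)
    (hout : (((A.erase v).erase u₁).erase u₂).card = 0)
    (t : ℝ) (hEN : 2 < ∑ a ∈ A, (prodBernoulli w).real (openConn o a))
    (hcut : ∀ a ∈ A, (prodBernoulli w).real (openConn o a : Set (BondConfig (Fin n)))ᶜ ≤ t) :
    (prodBernoulli w).real {ω : BondConfig (Fin n) | (A.filter fun a => ω ∈ openConn o a).card ≤ 1} ≤ t := by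
  set μ := prodBernoulli w with hμ
  have hmeas : ∀ U : Set (BondConfig (Fin n)), MeasurableSet U := fun U => (Set.toFinite U).measurableSet
  have hcomp : ∀ a : Fin n, μ.real (openConn o a : Set (BondConfig (Fin n)))ᶜ = 1 - μ.real (openConn o a) :=
    fun a => probReal_compl_eq_one_sub (hmeas _)
  -- `A = {v, u₁, u₂}`: the mean is `q_v + q₁ + q₂`
  have h1A' : u₁ ∈ A.erase v := mem_erase.2 ⟨h1v, h1A⟩
  have h2A' : u₂ ∈ (A.erase v).erase u₁ := mem_erase.2 ⟨h12.symm, mem_erase.2 ⟨h2v, h2A⟩⟩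
  have hempty : ((A.erase v).erase u₁).erase u₂ = ∅ := Finset.card_eq_zero.1 hout
  have hsumA : ∑ a ∈ A, μ.real (openConn o a) = μ.real (openConn o v) + μ.real (openConn o u₁) + μ.real (openConn o u₂) := by
    rw [← add_sum_erase A _ hvA, ← add_sum_erase (A.erase v) _ h1A', ← add_sum_erase ((A.erase v).erase u₁) _ h2A', hempty,
      sum_empty]
    ring
  -- the laws (files III, V, VIII)
  have hN := Gate3.real_card_le_one_le w hw hov h1v h2v ho1 ho2 h12 A hvA h1A h2A
  have hLv := Gate3.real_compl_openConn_v_eq (v := v) w hw hov h1v h2v ho1 ho2 h12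
  have hL1 := Gate3.real_compl_openConn_u₁_eq (v := v) w hw hov h1v h2v ho1 ho2 h12
  have hL2 := Gate3.real_compl_openConn_u₂_eq (v := v) w hw hov h1v h2v ho1 ho2 h12
  rw [← hμ] at hN hLv hL1 hL2
  have hqv : μ.real (openConn o v) = 1 - μ.real (openConn o v : Set (BondConfig (Fin n)))ᶜ := by rw [hcomp]; ring
  have hq1 : μ.real (openConn o u₁) = 1 - μ.real (openConn o u₁ : Set (BondConfig (Fin n)))ᶜ := by rw [hcomp]; ring
  have hq2 : μ.real (openConn o u₂) = 1 - μ.real (openConn o u₂ : Set (BondConfig (Fin n)))ᶜ := by rw [hcomp]; ring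
  have hcutv := hcut v hvA
  have hcut₁ := hcut u₁ h1A
  have hcut₂ := hcut u₂ h2A
  rw [hsumA, hqv, hq1, hq2] at hEN
  -- type masses, conversions and the union-Harris row (file V)
  have hx := Gate3.real_nG₁nG₂_eq (o := o) (v := v) (u₁ := u₁) (u₂ := u₂) μ
  have hy1 := Gate3.real_nG₁_eq (o := o) (v := v) (u₁ := u₁) (u₂ := u₂) μ
  have hy2 := Gate3.real_nG₂_eq (o := o) (v := v) (u₁ := u₁) (u₂ := u₂) μ
  have hnd := Gate3.real_nG₁G₂_eq (o := o) (v := v) (u₁ := u₁) (u₂ := u₂) μ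
  have hh1 := Gate3.real_nG₁nH_eq (o := o) (v := v) (u₁ := u₁) (u₂ := u₂) μ
  have hh2 := Gate3.real_nG₂nH_eq (o := o) (v := v) (u₁ := u₁) (u₂ := u₂) μ
  have hsum := Gate3.real_types_sum (o := o) (v := v) (u₁ := u₁) (u₂ := u₂) μ
  rw [probReal_univ] at hsum
  have hH1 := Gate3.real_harris₁ (o := o) (v := v) (u₁ := u₁) (u₂ := u₂) w
  rw [← hμ] at hH1
  -- abstract the five cells …
  generalize ha : μ.real {ω : BondConfig (Fin n) | ¬ (openGraph (offZ {v} ω)).Reachable o u₁ ∧ ¬ (openGraph (offZ {v} ω)).Reachable o u₂ ∧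
      ¬ (openGraph (offZ {v} ω)).Reachable u₁ u₂} = a at hx hh1 hh2 hsum hH1
  generalize hb1 : μ.real {ω : BondConfig (Fin n) | (openGraph (offZ {v} ω)).Reachable o u₁ ∧ ¬ (openGraph (offZ {v} ω)).Reachable o u₂} = b₁
    at hy2 hnd hh2 hsum
  generalize hb2 : μ.real {ω : BondConfig (Fin n) | (openGraph (offZ {v} ω)).Reachable o u₂ ∧ ¬ (openGraph (offZ {v} ω)).Reachable o u₁} = b₂
    at hy1 hh1 hsum
  generalize hc : μ.real {ω : BondConfig (Fin n) | ¬ (openGraph (offZ {v} ω)).Reachable o u₁ ∧ ¬ (openGraph (offZ {v} ω)).Reachable o u₂ ∧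
      (openGraph (offZ {v} ω)).Reachable u₁ u₂} = c at hx hsum
  generalize hd : μ.real {ω : BondConfig (Fin n) | (openGraph (offZ {v} ω)).Reachable o u₁ ∧ (openGraph (offZ {v} ω)).Reachable o u₂} = d
    at hsum
  -- … and the composite event probabilities
  generalize hxx : μ.real {ω : BondConfig (Fin n) | ¬ (openGraph (offZ {v} ω)).Reachable o u₁ ∧ ¬ (openGraph (offZ {v} ω)).Reachable o u₂} = x
    at hx hy1 hy2 hN hLv hL1 hL2
  generalize hyy1 : μ.real {ω : BondConfig (Fin n) | ¬ (openGraph (offZ {v} ω)).Reachable o u₁} = y₁ at hy1 hnd hN hLv hL1 hH1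
  generalize hyy2 : μ.real {ω : BondConfig (Fin n) | ¬ (openGraph (offZ {v} ω)).Reachable o u₂} = y₂ at hy2 hN hLv hL2
  generalize hhh1 : μ.real {ω : BondConfig (Fin n) | ¬ (openGraph (offZ {v} ω)).Reachable o u₁ ∧ ¬ (openGraph (offZ {v} ω)).Reachable u₂ u₁} = h₁
    at hh1 hL1
  generalize hhh2 : μ.real {ω : BondConfig (Fin n) | ¬ (openGraph (offZ {v} ω)).Reachable o u₂ ∧ ¬ (openGraph (offZ {v} ω)).Reachable u₁ u₂} = h₂
    at hh2 hL2 hH1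
  generalize hnn : μ.real {ω : BondConfig (Fin n) | ¬ ((openGraph (offZ {v} ω)).Reachable o u₁ ∧ (openGraph (offZ {v} ω)).Reachable o u₂)} = nd
    at hnd hN
  have hna : 0 ≤ a := by rw [← ha]; exact measureReal_nonneg
  have hnb1 : 0 ≤ b₁ := by rw [← hb1]; exact measureReal_nonneg
  have hnb2 : 0 ≤ b₂ := by rw [← hb2]; exact measureReal_nonneg
  have hnc : 0 ≤ c := by rw [← hc]; exact measureReal_nonneg
  subst hnd hy1 hy2 hx hh1 hh2
  rw [hLv] at hcutv hEN
  rw [hL1] at hcut₁ hEN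
  rw [hL2] at hcut₂ hEN
  have key := Gate3.cover_zero (w s(o, v) : ℝ) (w s(v, u₁) : ℝ) (w s(v, u₂) : ℝ)
    (w s(o, v)).2.1 (w s(o, v)).2.2 (w s(v, u₁)).2.1 (w s(v, u₁)).2.2 (w s(v, u₂)).2.1 (w s(v, u₂)).2.2
    t a b₁ b₂ c d hna hnb1 hnb2 hnc (by linarith [hsum]) (by linarith [hH1])
    (by linarith [hcutv]) (by linarith [hcut₁]) (by linarith [hcut₂]) (by linarith [hEN])
  linarith [hN, key]

/-- **FAR(1) at EVERY degree-three gate at the observer** — `farLayerOne_of_gate3` (p1 g37) WITHOUT the hypothesis `1 ≤ #(A ∖ {v,u₁,u₂})`: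
let `v ∈ A` be a relay whose only positive pairs lead to the observer `o` and to two relays `u₁, u₂ ∈ A` (any weights in `[0,1]`,
arbitrary environment, arbitrary further relays).  If the mean number of relays joined to `o` exceeds `2` and every cut `P(o ↮ a)`, `a ∈ A`,
is at most `t`, then `P(#{a ∈ A : o ↔ a} ≤ 1) ≤ t`. [this work] -/
theorem farLayerOne_of_gate3_all (w : Sym2 (Fin n) → unitInterval) (A : Finset (Fin n)) {o v u₁ u₂ : Fin n}
    (hov : o ≠ v) (h1v : u₁ ≠ v) (h2v : u₂ ≠ v) (ho1 : o ≠ u₁) (ho2 : o ≠ u₂) (h12 : u₁ ≠ u₂)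
    (hvA : v ∈ A) (h1A : u₁ ∈ A) (h2A : u₂ ∈ A)
    (hw : ∀ z : Fin n, z ≠ o → z ≠ u₁ → z ≠ u₂ → z ≠ v → (w s(v, z) : ℝ) = 0)
    (t : ℝ) (hEN : 2 < ∑ a ∈ A, (prodBernoulli w).real (openConn o a))
    (hcut : ∀ a ∈ A, (prodBernoulli w).real (openConn o a : Set (BondConfig (Fin n)))ᶜ ≤ t) :
    (prodBernoulli w).real {ω : BondConfig (Fin n) | (A.filter fun a => ω ∈ openConn o a).card ≤ 1} ≤ t := by
  rcases Nat.eq_zero_or_pos ((((A.erase v).erase u₁).erase u₂).card) with h0 | hpos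
  · exact farLayerOne_of_gate3_zero w A hov h1v h2v ho1 ho2 h12 hvA h1A h2A hw h0 t hEN hcut
  · exact farLayerOne_of_gate3 w A hov h1v h2v ho1 ho2 h12 hvA h1A h2A hw hpos t hEN hcut

end Quant

end Summit.CriticalPhenomena.PercolationContinuityZ3.Theorems
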